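import Mathlib
import Literature.Analysis.FluidPDE.VorticityEquation
import Summits.NavierStokesRegularity.NavierStokesRegularity.Theorems.ThreadingFluxCentreJetTimeJet
import Summits.NavierStokesRegularity.NavierStokesRegularity.Theorems.ThreadingFluxCentreJetLowestTermForced
import Summits.NavierStokesRegularity.NavierStokesRegularity.Theorems.ThreadingFluxCentreJetTriaxialRigidity
import HarnessLib

/-!
# Crux `PoloidalLiouville` (stmt-NavierStokesRegularity-1222, wall W1), crux idea «steady-centre-sieve» (ns-idea-15):
# ★ «EVOLUTION L1» — triaxial toroidal-jet rigidity ALONG A CLASSICAL NAVIER–STOKES EVOLUTION (kernel proof)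

Support file (`--supports stmt-NavierStokesRegularity-1222`, helper; cell `ns-wall-extremal`, width hand ns-wall-eng-7 g7, 0 kit).
The time-dependent companion of the card's lemma L1 `CentreJet.TriaxialToroidalJetRigidity` (ns-wall-eng-7 g6, p696348), sized by
the critic of record (ns-wall-crit-1 g5 05:58:44Z: no strike · M · information-grade):

`triaxialToroidalJetRigidity_evolution_of_timeSet` — let `(u, p)` be a classical Navier–Stokes solution (`ν = 1`, no force) on a time
set `S` of unique differentiability with `S ⊆ closure (interior S)` (every interval), such that at EVERY time `t ∈ S`: `u(t)` is
real-analytic on the ball `B(x₀, ρ)`, UNTHREADED about `x₀` there (`⟪x − x₀, curl u(t)(x)⟫ = 0`), `u(t)(x₀) = 0` (zero drift), `Du(t)(x₀)`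
has an orthonormal eigenframe with three distinct eigenvalues (triaxial strain; frame and eigenvalues may depend on `t`), and the
vorticity 2-jet vanishes, `D²(curl u(t))(x₀) = 0`.  Then `curl u(t) ≡ 0` on `B(x₀, ρ)` for every `t ∈ S`.
`triaxialToroidalJetRigidity_evolution` is the open-interval form `S = Ioo t₀ t₁` (the shape offered to the custodian ns-idea-15 for a
sketch Prop `TriaxialToroidalJetRigidityEvolution`).  Reusable pieces (no 2-jet hypothesis): `jetFacts_of_lower_evolution` — if all
diagonal Taylor terms of `curl u(s)` at `x₀` of degree `< k` vanish at every time, the degree-`k` term at each time satisfies L1's four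
jet facts (forced form); `diag_curl_eq_zero_of_lower_evolution` — the CORE STEP: with a triaxial frame and `k ≠ 2` that term vanishes at
every time; `curl_eq_zero_of_diag_two_evolution` — the strong induction on `k` (degree `2` = hypothesis, diagonal form) followed by
ns-wall-eng-5's `AnalyticOrder.eqOn_zero_of_diag_eq_zero`; `sum_eigen_eq_zero_of_divergence` (`Σ eᵢ = div`).

Proof of the core step (the critic's re-derivation, verbatim): at a time `t ∈ S` let `P(y) = Dᵏω(t)(x₀)(y,…,y)`, `ω = curl u`.  Every
diagonal term of degree `< k` of `ω(s)` vanishes for ALL `s ∈ S`, hence (file `…TimeJet`, `∂ₜ Dⁿ = Dⁿ ∂ₜ` for the jointly smooth vorticity)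
so does every such term of `G := ∂ₜω(t)`; and `⟪x − x₀, G(x)⟫ = ∂ₜ⟪x − x₀, ω(·, x)⟫ = 0` on the ball.  The vorticity equation of the tree
(`IsClassicalNSSolutionOn.vorticity_eq` + `curl_convect_self_of_isDivFree`) reads `Δω(t) = curl((u·∇)u)(t) + G`, so the FORCED jet facts
(file `…LowestTermForced`: (J4′) `ΔP = 0`, (J5′) loop law) hold together with the kinematic ones ((J2) `div P = 0`, (J3) `⟪y, P⟫ = 0`,
p695372); `k ≠ 2` by the 2-jet hypothesis at `t`, `Σ eᵢ = div u(t)(x₀) = 0`, and layer (4) `TriaxialFrame.eq_zero_of_jetFacts` (p694482,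
resting on the MvPolynomial core `HarmonicTangent.harmonicTangentRigidity` p692948 and ns-wall-eng-5's A1/A2) gives `P = 0`.
IMPORT-NEVER-RESTATE: L1's layers (2)(3a)(3b)(4), `AnalyticOrder`, the tree's vorticity equation — all BY NAME.

HONEST FRAME: special hypotheses (a stagnation point that stays triaxial, unthreaded and polhode-free for an interval of times is
non-generic); nothing bounded/ancient/mild is used; the statement leaves the steady stratum of the CentreJet line but stays far below
`PoloidalLiouville` (1222), which is OPEN, as is NS regularity; C1/C1*/C1″ untouched; movement on the wall: 0.
-/

-- the summit and its single sub-problem share the name (CONVENTIONS §1)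
set_option linter.dupNamespace false

noncomputable section

namespace Summit.NavierStokesRegularity.NavierStokesRegularity.Theorems.PoloidalLiouville.CentreJet

open Set Function Filter Topology Metric
open scoped ContDiff RealInnerProductSpace
open Literature.Analysis.FluidPDE

/-- `Σ eᵢ = div V(x₀)`: the eigenvalues of an orthonormal eigenframe of `DV(x₀)` sum to zero when `div V(x₀) = 0`. -/
theorem sum_eigen_eq_zero_of_divergence {V : E3 → E3} {x₀ : E3} (hdiv : VectorCalculus.divergence V x₀ = 0) {b : Fin 3 → E3}
    {e : Fin 3 → ℝ} (hb : Orthonormal ℝ b) (hSb : ∀ i, fderiv ℝ V x₀ (b i) = e i • b i) : ∑ i, e i = 0 := by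
  obtain ⟨ob, hob⟩ := TriaxialFrame.exists_orthonormalBasis_eq hb
  have h := hdiv
  rw [divergence_eq_sum_inner_fderiv ob] at h
  simp only [hob] at h
  rwa [TriaxialFrame.sum_inner_eigen hb (fderiv ℝ V x₀) hSb] at h

/-- **Jet facts along an evolution (forced form).**  For a classical Navier–Stokes solution (`ν = 1`, `f = 0`) on a time set `S` of
unique differentiability with `S ⊆ closure (interior S)` whose velocity is, at every `t ∈ S`, real-analytic on `ball x₀ ρ`, unthreaded
about `x₀` there and zero at `x₀`: if every diagonal Taylor term of `curl (u s)` at `x₀` of degree `< k` vanishes at EVERY time `s ∈ S`,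
then at each time `t ∈ S` the degree-`k` term `P(y) = Dᵏ(curl (u t))(x₀)(y,…,y)` satisfies L1's four jet facts: `div P = 0`, `⟪y, P⟫ = 0`,
`ΔP = 0`, `⟪y, DP(y)[Sy] − S P(y)⟫ = 0` with `S = D(u t)(x₀)`.  (The forcing `G = ∂ₜ curl u(t)` of the vorticity equation is invisible
below order `k` — `∂ₜ Dⁿ = Dⁿ ∂ₜ` — and tangent to the spheres — `⟪x − x₀, ∂ₜω⟫ = ∂ₜ⟪x − x₀, ω⟫ = 0`.) -/
theorem jetFacts_of_lower_evolution {S : Set ℝ} (hS : UniqueDiffOn ℝ S)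
    (hcl : S ⊆ closure (interior S)) {u : ℝ → E3 → E3} {p : ℝ → E3 → ℝ} (hNS : IsClassicalNSSolutionOn S 1 0 u p)
    {x₀ : E3} {ρ : ℝ} (hρ : 0 < ρ) (han : ∀ t ∈ S, AnalyticOnNhd ℝ (u t) (ball x₀ ρ))
    (hun : ∀ t ∈ S, ∀ x ∈ ball x₀ ρ, ⟪x - x₀, curl (u t) x⟫ = 0) (h0 : ∀ t ∈ S, u t x₀ = 0)
    {k : ℕ} (hlowAll : ∀ n < k, ∀ s ∈ S, ∀ y : E3, iteratedFDeriv ℝ n (curl (u s)) x₀ (fun _ => y) = 0) {t : ℝ} (ht : t ∈ S) :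
    (∀ y, VectorCalculus.divergence (fun y : E3 => iteratedFDeriv ℝ k (curl (u t)) x₀ (fun _ => y)) y = 0) ∧
    (∀ y : E3, ⟪y, iteratedFDeriv ℝ k (curl (u t)) x₀ (fun _ => y)⟫ = 0) ∧
    (∀ y, Laplacian.laplacian (fun y : E3 => iteratedFDeriv ℝ k (curl (u t)) x₀ (fun _ => y)) y = 0) ∧
    (∀ y : E3, ⟪y, fderiv ℝ (fun y : E3 => iteratedFDeriv ℝ k (curl (u t)) x₀ (fun _ => y)) y (fderiv ℝ (u t) x₀ y) -
      fderiv ℝ (u t) x₀ (iteratedFDeriv ℝ k (curl (u t)) x₀ (fun _ => y))⟫ = 0) := by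
  have hx₀ : x₀ ∈ ball x₀ ρ := mem_ball_self hρ
  have hball : ball x₀ ρ ∈ 𝓝 x₀ := ball_mem_nhds x₀ hρ
  -- work at the time `t`, with `V := u t`, `ω := curl V`, forcing `G := ∂ₜω(t)`
  set V : E3 → E3 := u t with hV
  have hVsm : ContDiff ℝ ∞ V := hNS.contDiff_velocity ht
  have hV3 : ContDiff ℝ 3 V := hVsm.of_le (by norm_cast)
  have hV2 : ContDiff ℝ 2 V := hVsm.of_le (by norm_cast)
  have hVω : ContDiffAt ℝ ω V x₀ := (han t ht x₀ hx₀).contDiffAt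
  have hdivV : VectorCalculus.IsDivFree V := hNS.divFree t ht
  have hdiv' : ∀ᶠ x in 𝓝 x₀, VectorCalculus.divergence V x = 0 := Eventually.of_forall hdivV
  have htan' : ∀ᶠ x in 𝓝 x₀, ⟪x - x₀, curl V x⟫ = 0 := by
    filter_upwards [hball] with x hx using hun t ht x hx
  have hlow : ∀ n < k, ∀ y : E3, iteratedFDeriv ℝ n (curl V) x₀ (fun _ => y) = 0 := fun n hn y => hlowAll n hn t ht y
  -- the vorticity is jointly smooth; the forcing `G = ∂ₜω(t)`
  have hvsm : IsSmoothSpaceTimeOn S (vorticity u) := by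
    have e : vorticity u = fun s y => curlCLM (fderiv ℝ (u s) y) := by
      funext s y; rfl
    rw [e]
    exact (hNS.smooth_velocity.fderiv_slice hS).clm_comp curlCLM
  set G : E3 → E3 := timeDerivWithin S (vorticity u) t with hG
  have hGsm : ContDiffAt ℝ ∞ G x₀ := ((hvsm.timeDerivWithin hS).contDiff_slice ht).contDiffAt
  -- (i) the diagonal terms of `G` of degree `< k` vanish: `∂ₜ Dⁿ = Dⁿ ∂ₜ` and the vanishing of the lower terms at ALL times
  have hGlow : ∀ n < k, ∀ y : E3, iteratedFDeriv ℝ n G x₀ (fun _ => y) = 0 := fun n hn y =>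
    JetCalculus.diag_timeDerivWithin_eq_zero hvsm hS hcl n ht x₀ y (fun s hs => hlowAll n hn s hs y)
  -- (ii) `G` is tangent to the spheres about `x₀` on the ball: `⟪x − x₀, ∂ₜω⟫ = ∂ₜ ⟪x − x₀, ω⟫ = 0`
  have hGtan : ∀ᶠ x in 𝓝 x₀, ⟪x - x₀, G x⟫ = 0 := by
    filter_upwards [hball] with x hx
    have h1 := hvsm.timeDerivWithin_clm_comp hS (innerSL ℝ (x - x₀)) ht x
    simp only [innerSL_apply_apply] at h1
    rw [hG, ← h1, timeDerivWithin_apply]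
    have hzero : ∀ s ∈ S, ⟪x - x₀, vorticity u s x⟫ = (fun _ : ℝ => (0 : ℝ)) s := fun s hs => hun s hs x hx
    rw [derivWithin_congr hzero (hzero t ht)]
    simp
  -- (iii) the FORCED vorticity equation at time `t`: `Δω = curl((V·∇)V) + G`
  have hcurlf : ∀ s ∈ S, ∀ x, curl ((0 : ℝ → E3 → E3) s) x = 0 := fun _ _ x => curl_zero x
  have hvort_pt : ∀ x, Laplacian.laplacian (curl V) x = curl (fun z => fderiv ℝ V z (V z)) x + G x := by
    intro x
    have h1 := hNS.vorticity_eq hS hcl hcurlf ht x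
    rw [vorticity_apply, one_smul, ← hG, ← hV] at h1
    have hcv : (fun z => fderiv ℝ V z (V z)) = convect V V := rfl
    rw [hcv, curl_convect_self_of_isDivFree hV2 hdivV x, eq_sub_of_add_eq' h1.symm]
    abel
  have hvort : Laplacian.laplacian (curl V) =ᶠ[𝓝 x₀] fun x => curl (fun z => fderiv ℝ V z (V z)) x + G x :=
    Eventually.of_forall hvort_pt
  -- the jet facts: (J2)(J3) kinematic (p695372), (J4′)(J5′) forced
  exact ⟨LowestTerm.divergence_lowestTerm hV2 hVω k, LowestTerm.tangent_lowestTerm hVω htan' hlow,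
    LowestTerm.laplacian_lowestTerm_forced hV2 hVω hvort hGsm hdiv' (h0 t ht) hGlow hlow,
    LowestTerm.loopLaw_lowestTerm_forced hV3 hVω hvort hGtan hdiv' htan' (h0 t ht) hlow⟩

/-- **The order ladder (core step).**  In the same setting plus a triaxial orthonormal eigenframe of `D(u t)(x₀)` at every time: if `k ≠ 2`
and every diagonal Taylor term of `curl (u s)` at `x₀` of degree `< k` vanishes at EVERY time `s ∈ S`, then so does the degree-`k` term, at
every time (jet facts + `Σ eᵢ = div u(t)(x₀) = 0` + layer (4) `TriaxialFrame.eq_zero_of_jetFacts`). -/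
theorem diag_curl_eq_zero_of_lower_evolution {S : Set ℝ} (hS : UniqueDiffOn ℝ S)
    (hcl : S ⊆ closure (interior S)) {u : ℝ → E3 → E3} {p : ℝ → E3 → ℝ} (hNS : IsClassicalNSSolutionOn S 1 0 u p)
    {x₀ : E3} {ρ : ℝ} (hρ : 0 < ρ) (han : ∀ t ∈ S, AnalyticOnNhd ℝ (u t) (ball x₀ ρ))
    (hun : ∀ t ∈ S, ∀ x ∈ ball x₀ ρ, ⟪x - x₀, curl (u t) x⟫ = 0) (h0 : ∀ t ∈ S, u t x₀ = 0)
    (hframe : ∀ t ∈ S, ∃ (b : Fin 3 → E3) (e : Fin 3 → ℝ), Orthonormal ℝ b ∧ Function.Injective e ∧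
      ∀ i, fderiv ℝ (u t) x₀ (b i) = e i • b i)
    {k : ℕ} (hk2 : k ≠ 2) (hlowAll : ∀ n < k, ∀ s ∈ S, ∀ y : E3, iteratedFDeriv ℝ n (curl (u s)) x₀ (fun _ => y) = 0) :
    ∀ t ∈ S, ∀ y : E3, iteratedFDeriv ℝ k (curl (u t)) x₀ (fun _ => y) = 0 := by
  intro t ht y₀
  obtain ⟨hdivP, htanP, hharmP, hloopP⟩ := jetFacts_of_lower_evolution hS hcl hNS hρ han hun h0 hlowAll ht
  obtain ⟨b, e, hb, he, hSb⟩ := hframe t ht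
  have htr : ∑ i, e i = 0 := sum_eigen_eq_zero_of_divergence (hNS.divFree t ht x₀) hb hSb
  have hP0 := TriaxialFrame.eq_zero_of_jetFacts (fun y : E3 => iteratedFDeriv ℝ k (curl (u t)) x₀ (fun _ => y)) hk2
    (JetCalculus.contDiff_diag k) (fun c y => JetCalculus.diag_smul k c y) hdivP htanP hharmP (fderiv ℝ (u t) x₀) b e hb he hSb htr
    hloopP
  exact congrFun hP0 y₀

/-- **All orders from order two (diagonal form).**  In the setting of the core step: if the DIAGONAL vorticity 2-jet
`D²(curl (u t))(x₀)(y, y)` vanishes at every time, then `curl (u t) ≡ 0` on `ball x₀ ρ` at every time (strong induction on the degree with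
the core step, degree `2` being the hypothesis; then every diagonal Taylor term of the analytic germ `curl (u t)` vanishes, so it vanishes
on the ball — ns-wall-eng-5 `AnalyticOrder.eqOn_zero_of_diag_eq_zero`). -/
theorem curl_eq_zero_of_diag_two_evolution {S : Set ℝ} (hS : UniqueDiffOn ℝ S)
    (hcl : S ⊆ closure (interior S)) {u : ℝ → E3 → E3} {p : ℝ → E3 → ℝ} (hNS : IsClassicalNSSolutionOn S 1 0 u p)
    {x₀ : E3} {ρ : ℝ} (hρ : 0 < ρ) (han : ∀ t ∈ S, AnalyticOnNhd ℝ (u t) (ball x₀ ρ))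
    (hun : ∀ t ∈ S, ∀ x ∈ ball x₀ ρ, ⟪x - x₀, curl (u t) x⟫ = 0) (h0 : ∀ t ∈ S, u t x₀ = 0)
    (hframe : ∀ t ∈ S, ∃ (b : Fin 3 → E3) (e : Fin 3 → ℝ), Orthonormal ℝ b ∧ Function.Injective e ∧
      ∀ i, fderiv ℝ (u t) x₀ (b i) = e i • b i)
    (h2 : ∀ t ∈ S, ∀ y : E3, iteratedFDeriv ℝ 2 (curl (u t)) x₀ (fun _ => y) = 0) :
    ∀ t ∈ S, ∀ x ∈ ball x₀ ρ, curl (u t) x = 0 := by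
  -- every diagonal Taylor term of every `curl (u t)` at `x₀` vanishes
  have hall : ∀ (k : ℕ), ∀ t ∈ S, ∀ y : E3, iteratedFDeriv ℝ k (curl (u t)) x₀ (fun _ => y) = 0 := by
    intro k
    induction k using Nat.strong_induction_on with
    | _ k ih =>
      by_cases hk2 : k = 2
      · subst hk2
        exact h2
      · exact diag_curl_eq_zero_of_lower_evolution hS hcl hNS hρ han hun h0 hframe hk2 (fun n hn s hs y => ih n hn s hs y)
  intro t ht
  exact AnalyticOrder.eqOn_zero_of_diag_eq_zero (analyticOnNhd_curl (han t ht)) (convex_ball x₀ ρ).isPreconnected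
    (mem_ball_self hρ) (fun n y => hall n t ht y)

/-- ★ **«EVOLUTION L1» on a general time set.**  For a classical Navier–Stokes solution (`ν = 1`, `f = 0`) on a time set `S` of unique
differentiability with `S ⊆ closure (interior S)`: if at every `t ∈ S` the velocity `u t` is real-analytic on `ball x₀ ρ`, unthreaded
about `x₀` there, vanishes at `x₀`, has a triaxial orthonormal eigenframe of `D(u t)(x₀)`, and `D²(curl (u t))(x₀) = 0`, then
`curl (u t) ≡ 0` on `ball x₀ ρ` for every `t ∈ S`. -/
theorem triaxialToroidalJetRigidity_evolution_of_timeSet {S : Set ℝ} (hS : UniqueDiffOn ℝ S)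
    (hcl : S ⊆ closure (interior S)) {u : ℝ → E3 → E3} {p : ℝ → E3 → ℝ} (hNS : IsClassicalNSSolutionOn S 1 0 u p)
    {x₀ : E3} {ρ : ℝ} (hρ : 0 < ρ) (han : ∀ t ∈ S, AnalyticOnNhd ℝ (u t) (ball x₀ ρ))
    (hun : ∀ t ∈ S, ∀ x ∈ ball x₀ ρ, ⟪x - x₀, curl (u t) x⟫ = 0) (h0 : ∀ t ∈ S, u t x₀ = 0)
    (hframe : ∀ t ∈ S, ∃ (b : Fin 3 → E3) (e : Fin 3 → ℝ), Orthonormal ℝ b ∧ Function.Injective e ∧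
      ∀ i, fderiv ℝ (u t) x₀ (b i) = e i • b i)
    (h2 : ∀ t ∈ S, fderiv ℝ (fderiv ℝ (curl (u t))) x₀ = 0) :
    ∀ t ∈ S, ∀ x ∈ ball x₀ ρ, curl (u t) x = 0 :=
  curl_eq_zero_of_diag_two_evolution hS hcl hNS hρ han hun h0 hframe fun t ht y => by
    rw [iteratedFDeriv_two_apply, h2 t ht]
    rfl

/-- ★ **«EVOLUTION L1»** (open time interval; the shape offered for the sketch Prop `TriaxialToroidalJetRigidityEvolution`):
for a classical Navier–Stokes evolution `(u, p)` (`ν = 1`, no force) on `(t₀, t₁) × ℝ³` such that at every time `u(t)` is real-analytic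
on `ball x₀ ρ`, unthreaded about `x₀` there, `u(t)(x₀) = 0`, `Du(t)(x₀)` has a triaxial orthonormal eigenframe, and `D²(curl u(t))(x₀) = 0`:
`curl u(t) ≡ 0` on the ball for every `t ∈ (t₀, t₁)`. -/
theorem triaxialToroidalJetRigidity_evolution :
    ∀ (u : ℝ → E3 → E3) (p : ℝ → E3 → ℝ) (x₀ : E3) (ρ t₀ t₁ : ℝ), 0 < ρ → t₀ < t₁ →
      IsClassicalNSSolutionOn (Ioo t₀ t₁) 1 0 u p →
      (∀ t ∈ Ioo t₀ t₁, AnalyticOnNhd ℝ (u t) (Metric.ball x₀ ρ)) →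
      (∀ t ∈ Ioo t₀ t₁, ∀ x ∈ Metric.ball x₀ ρ, inner ℝ (x - x₀) (curl (u t) x) = 0) →
      (∀ t ∈ Ioo t₀ t₁, u t x₀ = 0) →
      (∀ t ∈ Ioo t₀ t₁, ∃ (b : Fin 3 → E3) (e : Fin 3 → ℝ), Orthonormal ℝ b ∧ Function.Injective e ∧
        ∀ i, fderiv ℝ (u t) x₀ (b i) = e i • b i) →
      (∀ t ∈ Ioo t₀ t₁, fderiv ℝ (fderiv ℝ (curl (u t))) x₀ = 0) →
      ∀ t ∈ Ioo t₀ t₁, ∀ x ∈ Metric.ball x₀ ρ, curl (u t) x = 0 := by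
  intro u p x₀ ρ t₀ t₁ hρ _ hNS han hun h0 hframe h2
  exact triaxialToroidalJetRigidity_evolution_of_timeSet isOpen_Ioo.uniqueDiffOn
    (by rw [interior_Ioo]; exact subset_closure) hNS hρ han hun h0 hframe h2

end Summit.NavierStokesRegularity.NavierStokesRegularity.Theorems.PoloidalLiouville.CentreJet

end
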